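import Literature.Topology.FourManifolds.RotationBodyBoundary
import Mathlib.Topology.Homotopy.Equiv
import HarnessLib

/-!
# Kervaire–Milnor's rotation body retracts onto the punctured manifold (proof of Lemma 2.4, homotopy half)

Topic `Literature/Topology/FourManifolds`, continuation of `RotationBody.lean` and
`RotationBodyBoundary.lean` (the file announced there as `RotationBodyRetract.lean`). Kervaire–Milnor,
*Groups of homotopy spheres I*, Ann. of Math. 77 (1963), proof of Lemma 2.4 (p. 507): the rotation
body `W = (M - i(½D̊ⁿ)) × [0, π] ∪_ψ Sⁿ⁻¹ × H²` "contains `M - Interior i(½Dⁿ)` as deformation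
retract, and therefore is contractible" (when `M` is a homotopy sphere).

Here we prove the homotopy-theoretic content of this sentence in the form consumed by the tree's
decomposition of Lemma 2.4 (`HomotopySpheresInverse.lean`, named fact
`Literature.Topology.FourManifolds.HomotopySphere.exists_nullCobordism_isOrientedConnectedSum_neg`):
**the rotation body `W` of `M` along the disc `i` is homotopy equivalent to the punctured manifold
`M ∖ {i 0}`** (which deformation retracts onto `M - Interior i(½Dⁿ)`), for every Hausdorff smooth
manifold `M` and every rotation datum:

* `RotationData.retr : W → M ∖ {i 0}`, `(x, s) ↦ x` on the cylinder `M' × [0, 1]` and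
  `(w, z) ↦ i(((1 + ‖z‖)/2) w)` on the half-disc bundle (compatible with the gluing `ψ`);
* `RotationData.sect : M ∖ {i 0} → W`, the face map `bdryMap 0` of `RotationBodyBoundary.lean`
  (`x ↦ (x, 0)` off the unit disc, `i(v) ↦ (v/‖v‖, (2‖v‖ - 1)·(0, 1))` on it);
* `retr ∘ sect ≃ id` by a radial homotopy inside the disc (`RotationData.homotopyRetrSect`), and
  `sect ∘ retr ≃ id` by the homotopy `(x, s) ↦ (x, τs)`, `(w, z) ↦ (w, ‖z‖·rot(τ θ(z)/π))` which
  turns the half-disc fibres back onto the diameter (`RotationData.homotopySectRetr`);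
* `RotationData.homotopyEquivPunct : W ≃ₕ (M ∖ {i 0})`.

We also record the orientation bookkeeping of the same proof ("`bW = M # (-M)`" as an *oriented*
connected sum): for an oriented `M` and a constant orientation `o₀` of `ℝᵐ⁺¹` for which the disc
`i` preserves orientation, the double `P₀` glued from the data `(e, e)` is an oriented connected
sum of `(M, o)` and `(M, -o)` (`RotationData.isOrientedConnectedSum_P₀`), since `i : (ℝᵐ⁺¹, o₀) →
(M, -o)` reverses orientation. The assembly of the named fact of `HomotopySpheresInverse.lean` from
these two results and `RotationData.nullCobordism` is in `HomotopySpheresInverseProofs.lean`.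

## References

* M. Kervaire, J. Milnor, *Groups of homotopy spheres I*, Ann. of Math. (2) 77 (1963), 504–537,
  proof of Lemma 2.4 (p. 507). doi:10.2307/1970128 [KervaireMilnorAnnals1963]
-/

open scoped Manifold ContDiff Topology unitInterval ContinuousMap
open Set Function Metric Real

noncomputable section

universe u

namespace Literature.Topology.FourManifolds

/-- Local notation: `𝔼 n` is the model Euclidean space `EuclideanSpace ℝ (Fin n)`. -/
local notation "𝔼 " n:arg => EuclideanSpace ℝ (Fin n)
/-- Local notation: `𝕊 m` is the unit sphere in `EuclideanSpace ℝ (Fin (m + 1))`. -/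
local notation "𝕊 " m:arg => (Metric.sphere (0 : EuclideanSpace ℝ (Fin (m + 1))) 1)

namespace RotationData

open RotationBody

variable {m : ℕ} {M : Type u} [TopologicalSpace M] [ChartedSpace (𝔼 (m + 1)) M] [T2Space M]
  [IsManifold (𝓡 (m + 1)) ∞ M] (R : RotationData m M)

attribute [local instance] Classical.propDecidable

/-! ### The retraction `W → M ∖ {i 0}` -/

omit [T2Space M] [IsManifold (𝓡 (m + 1)) ∞ M] in
/-- The point `i(((1 + ‖z‖)/2) w)` under a point `(w, z)` of the half-disc bundle is not the
centre `i 0` (its coordinate has norm `(1 + ‖z‖)/2 > 0`). [folklore] -/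
theorem invPt_ne_center (b : B m) : R.invPt b ≠ R.i 0 := by
  intro h
  have h' : invRadius b • (b.1.1 : 𝔼 (m + 1)) = 0 := R.i_injective h
  have hn : ‖invRadius b • (b.1.1 : 𝔼 (m + 1))‖ = invRadius b := norm_invRadius_smul b
  rw [h', norm_zero] at hn
  exact (invRadius_pos b).ne hn

/-- The point of `M ∖ {i 0}` under a point `(w, z)` of the half-disc bundle:
`i(((1 + ‖z‖)/2) w)` (Kervaire–Milnor's deformation of the half-disc `H²` onto its diameter, read
in `M`). [cite: KervaireMilnorAnnals1963, Lemma 2.4, proof (p. 507)] -/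
def retrB (b : B m) : ↥R.Mpunct := ⟨R.invPt b, R.invPt_ne_center b⟩

omit [IsManifold (𝓡 (m + 1)) ∞ M] in
/-- The underlying point of `retrB (w, z)` is `i(((1 + ‖z‖)/2) w)`. [folklore] -/
@[simp] theorem coe_retrB (b : B m) : (R.retrB b : M) = R.invPt b := rfl

omit [IsManifold (𝓡 (m + 1)) ∞ M] in
/-- `retrB` is continuous. [folklore] -/
theorem continuous_retrB : Continuous R.retrB :=
  R.continuous_invPt.subtype_mk _

omit [IsManifold (𝓡 (m + 1)) ∞ M] in
/-- On the overlap the two formulas agree: `i(((1 + ‖z‖)/2) w) = x` for `(w, z) = ψ (x, s)`.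
[folklore] -/
theorem invPt_glueFun {a : R.A} (ha : a ∈ R.glueSource) : R.invPt (R.glueFun a) = (a.1.1 : M) := by
  have hv0 := R.e_ne_zero_of_mem_glueSource ha
  have hrad : invRadius (R.glueFun a) = ‖R.e a.1.1‖ := by
    rw [invRadius, glueFun_coe_snd, R.norm_glueVec_of_mem ha]; ring
  rw [invPt, hrad, glueFun_coe_fst, glueSph, norm_smul_coe_sphN hv0, R.i_e ha.1]

/-- The two pieces of the retraction are compatible with the gluing. [folklore] -/
theorem ptA_compat (a : R.A) (ha : a ∈ R.glueData.glue.source) :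
    R.ptA a = R.retrB (R.glueData.glue a) := by
  apply Subtype.ext
  rw [coe_ptA, coe_retrB, glueData_glue, glue_apply, R.invPt_glueFun ha]

/-- **The retraction `r : W → M ∖ {i 0}`** of the rotation body onto the punctured manifold:
`(x, s) ↦ x` on the cylinder and `(w, z) ↦ i(((1 + ‖z‖)/2) w)` on the half-disc bundle
(Kervaire–Milnor 1963, proof of Lemma 2.4: "`W` contains `M - Interior i(½Dⁿ)` as deformation
retract"). [cite: KervaireMilnorAnnals1963, Lemma 2.4, proof (p. 507)] -/
def retr : R.W → ↥R.Mpunct :=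
  R.glueData.lift R.ptA R.retrB R.ptA_compat

/-- The retraction on the cylinder is `(x, s) ↦ x`. [folklore] -/
@[simp] theorem retr_inl (a : R.A) : R.retr (R.glueData.inl a) = R.ptA a := rfl

/-- The retraction on the half-disc bundle is `(w, z) ↦ i(((1 + ‖z‖)/2) w)`. [folklore] -/
@[simp] theorem retr_inr (b : B m) : R.retr (R.glueData.inr b) = R.retrB b := rfl

/-- The retraction is continuous. [folklore] -/
theorem continuous_retr : Continuous R.retr :=
  R.glueData.continuous_lift R.contMDiff_ptA.continuous R.continuous_retrB

/-- The retraction as a continuous map. [folklore] -/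
def retrCM : C(R.W, ↥R.Mpunct) := ⟨R.retr, R.continuous_retr⟩

/-- `retrCM` is `retr` as a function (definitional). [folklore] -/
@[simp] theorem retrCM_apply (p : R.W) : R.retrCM p = R.retr p := rfl

/-! ### The section `M ∖ {i 0} → W` -/

/-- **The section `j : M ∖ {i 0} → W`**, the face map at `s = 0` of `RotationBodyBoundary.lean`:
`x ↦ (x, 0)` off the unit disc and `i(v) ↦ (v/‖v‖, (2‖v‖ - 1)·(0, 1))` on the punctured unit disc
(Kervaire–Milnor's copy `M × 0` of `M - Interior i(½Dⁿ)`, continued along the diameter of `H²`).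
[cite: KervaireMilnorAnnals1963, Lemma 2.4, proof (p. 507)] -/
def sect : ↥R.Mpunct → R.W := R.bdryMap 0 face_zero

/-- `sect` is `bdryMap 0` (definitional). [folklore] -/
theorem sect_def : R.sect = R.bdryMap 0 face_zero := rfl

/-- The section is continuous. [folklore] -/
theorem continuous_sect : Continuous R.sect := R.continuous_bdryMap 0 face_zero

/-- The section as a continuous map. [folklore] -/
def sectCM : C(↥R.Mpunct, R.W) := ⟨R.sect, R.continuous_sect⟩

/-- `sectCM` is `sect` as a function (definitional). [folklore] -/
@[simp] theorem sectCM_apply (y : ↥R.Mpunct) : R.sectCM y = R.sect y := rfl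

/-- Off the closed half-disc (`y ∈ M'`) the section is `y ↦ (y, 0)`. [folklore] -/
theorem sect_of_mem_M' {y : ↥R.Mpunct} (hy : (y : M) ∈ R.M') :
    R.sect y = R.glueData.inl (R.mkA ⟨y, hy⟩ 0 (mem_Icc_of_face face_zero)) :=
  R.bdryMap_of_mem_M' hy

/-- On the punctured unit disc the section is the diameter formula. [folklore] -/
theorem sect_of_mem_discSet {y : ↥R.Mpunct} (hy : y ∈ R.discSet) :
    R.sect y = R.glueData.inr (diamB 0 face_zero (R.e y)) :=
  R.bdryMap_of_mem_discSet hy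

/-! ### `retr ∘ sect` -/

/-- Off the closed half-disc, `retr (sect y) = y`. [folklore] -/
theorem retr_sect_of_mem_M' {y : ↥R.Mpunct} (hy : (y : M) ∈ R.M') : R.retr (R.sect y) = y := by
  rw [R.sect_of_mem_M' hy, retr_inl]
  rfl

/-- On the punctured unit disc, `retr (sect (i v)) = i(((1 + |2‖v‖ - 1|)/2) v/‖v‖)`. [folklore] -/
theorem coe_retr_sect_of_mem_discSet {y : ↥R.Mpunct} (hy : y ∈ R.discSet) :
    (R.retr (R.sect y) : M) =
      R.i (invRadius (diamB 0 face_zero (R.e y)) • (sphN (R.e y) : 𝔼 (m + 1))) := by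
  rw [R.sect_of_mem_discSet hy, retr_inr, coe_retrB, invPt, diamB_coe_fst]


/-! ### The homotopy `retr ∘ sect ≃ id` -/

omit [T2Space M] [IsManifold (𝓡 (m + 1)) ∞ M] in
/-- On the annulus `½ < ‖v‖ < 1` the radius `(1 + ‖(2‖v‖ - 1)·(0,1)‖)/2` of `retr ∘ sect` is `‖v‖`
(there `retr ∘ sect` is the identity). [folklore] -/
theorem _root_.Literature.Topology.FourManifolds.RotationBody.invRadius_diamB_of_half_lt
    {v : 𝔼 (m + 1)} (hv : 2⁻¹ < ‖v‖) (hv1 : ‖v‖ < 1) :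
    invRadius (diamB 0 face_zero v) = ‖v‖ := by
  have hv0 : 0 < ‖v‖ := lt_trans (by norm_num) hv
  rw [invRadius, diamB_coe_snd, dV_of_mem ⟨hv0, hv1⟩, norm_smul, norm_rot, mul_one, Real.norm_eq_abs,
    abs_of_pos (by linarith)]
  ring

omit [T2Space M] [IsManifold (𝓡 (m + 1)) ∞ M] in
/-- The radius `(1 + ‖dV 0 v‖)/2` of `retr ∘ sect` depends continuously on `v` on the punctured
unit disc. [folklore] -/
theorem _root_.Literature.Topology.FourManifolds.RotationBody.continuousOn_invRadius_diamB :
    ContinuousOn (fun v : 𝔼 (m + 1) => invRadius (diamB 0 face_zero v))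
      {v | 0 < ‖v‖ ∧ ‖v‖ < 1} := by
  have h : Continuous fun v : 𝔼 (m + 1) => (1 + ‖(2 * ‖v‖ - 1) • rot 0‖) / 2 := by fun_prop
  refine h.continuousOn.congr fun v hv => ?_
  simp only [invRadius, diamB_coe_snd, dV_of_mem hv]

/-- The radius at time `τ` of the radial homotopy from `retr ∘ sect` (`τ = 0`) to the identity
(`τ = 1`) over a point `i(v)` of the punctured unit disc. [folklore] -/
def _root_.Literature.Topology.FourManifolds.RotationBody.rsRadius (τ : ℝ) (v : 𝔼 (m + 1)) : ℝ :=
  (1 - τ) * invRadius (diamB 0 face_zero v) + τ * ‖v‖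

omit [T2Space M] [IsManifold (𝓡 (m + 1)) ∞ M] in
/-- The radius of the radial homotopy is positive. [folklore] -/
theorem _root_.Literature.Topology.FourManifolds.RotationBody.rsRadius_pos {τ : ℝ} (hτ : τ ∈ Icc (0 : ℝ) 1)
    {v : 𝔼 (m + 1)} (hv : 0 < ‖v‖) : 0 < rsRadius τ v := by
  have h1 := invRadius_pos (diamB (m := m) 0 face_zero v)
  rw [rsRadius]
  rcases eq_or_lt_of_le hτ.2 with rfl | hlt
  · simpa using hv
  · nlinarith [hτ.1]

omit [T2Space M] [IsManifold (𝓡 (m + 1)) ∞ M] in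
/-- On the annulus `½ < ‖v‖ < 1` the radius of the radial homotopy is constantly `‖v‖`. [folklore] -/
theorem _root_.Literature.Topology.FourManifolds.RotationBody.rsRadius_of_half_lt (τ : ℝ) {v : 𝔼 (m + 1)}
    (hv : 2⁻¹ < ‖v‖) (hv1 : ‖v‖ < 1) : rsRadius τ v = ‖v‖ := by
  rw [rsRadius, invRadius_diamB_of_half_lt hv hv1]; ring

omit [IsManifold (𝓡 (m + 1)) ∞ M] in
/-- The point `i(ρ v/‖v‖)` of the radial homotopy lies in `M ∖ {i 0}`. [folklore] -/
theorem i_rsRadius_mem {τ : ℝ} (hτ : τ ∈ Icc (0 : ℝ) 1) {y : ↥R.Mpunct} (hy : y ∈ R.discSet) :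
    R.i (rsRadius τ (R.e y) • (sphN (R.e y) : 𝔼 (m + 1))) ∈ R.Mpunct := by
  refine R.i_mem_Mpunct (smul_ne_zero (rsRadius_pos hτ (R.norm_mem_of_mem_discSet hy).1).ne' ?_)
  exact ne_zero_of_mem_unit_sphere _

omit [IsManifold (𝓡 (m + 1)) ∞ M] in
/-- **The radial homotopy from `retr ∘ sect` to the identity of `M ∖ {i 0}`**: the identity off the
unit disc, and `i(v) ↦ i(ρ_τ(v) v/‖v‖)` with `ρ_τ(v) = (1 - τ)(1 + |2‖v‖ - 1|)/2 + τ‖v‖` on the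
punctured unit disc. [folklore] -/
def homRS (q : I × ↥R.Mpunct) : ↥R.Mpunct :=
  if h : q.2 ∈ R.discSet then
    ⟨R.i (rsRadius q.1 (R.e q.2) • (sphN (R.e q.2) : 𝔼 (m + 1))), R.i_rsRadius_mem q.1.2 h⟩
  else q.2

omit [IsManifold (𝓡 (m + 1)) ∞ M] in
/-- The radial homotopy on the punctured unit disc. [folklore] -/
theorem homRS_of_mem_discSet {q : I × ↥R.Mpunct} (h : q.2 ∈ R.discSet) :
    R.homRS q = ⟨R.i (rsRadius q.1 (R.e q.2) • (sphN (R.e q.2) : 𝔼 (m + 1))),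
      R.i_rsRadius_mem q.1.2 h⟩ :=
  dif_pos h

omit [IsManifold (𝓡 (m + 1)) ∞ M] in
/-- The radial homotopy is the identity off the closed half-disc (`y ∈ M'`). [folklore] -/
theorem homRS_of_mem_M' {q : I × ↥R.Mpunct} (h : (q.2 : M) ∈ R.M') : R.homRS q = q.2 := by
  by_cases hd : q.2 ∈ R.discSet
  · rw [R.homRS_of_mem_discSet hd]
    have hv := (R.mem_M'_iff_of_mem_source hd.1).1 h
    have hv0 : R.e q.2 ≠ 0 := norm_pos_iff.1 (R.norm_mem_of_mem_discSet hd).1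
    apply Subtype.ext
    simp only
    rw [rsRadius_of_half_lt _ hv hd.2, norm_smul_coe_sphN hv0, R.i_e hd.1]
  · exact dif_neg hd

omit [IsManifold (𝓡 (m + 1)) ∞ M] in
/-- The coordinate `q ↦ e q.2` is continuous on `I × discSet`. [folklore] -/
theorem continuousOn_e_snd :
    ContinuousOn (fun q : I × ↥R.Mpunct => R.e q.2) {q | q.2 ∈ R.discSet} :=
  R.contMDiffOn_e_punct.continuousOn.comp continuous_snd.continuousOn fun _ hq => hq

omit [IsManifold (𝓡 (m + 1)) ∞ M] in
/-- The radial homotopy is continuous on `I × discSet`. [folklore] -/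
theorem continuousOn_homRS_discSet : ContinuousOn R.homRS {q | q.2 ∈ R.discSet} := by
  have hne : ∀ q : I × ↥R.Mpunct, q ∈ {q : I × ↥R.Mpunct | q.2 ∈ R.discSet} → R.e q.2 ≠ 0 :=
    fun q hq => norm_pos_iff.1 (R.norm_mem_of_mem_discSet hq).1
  have hrad : ContinuousOn (fun q : I × ↥R.Mpunct => rsRadius q.1 (R.e q.2))
      {q | q.2 ∈ R.discSet} := by
    have h1 : ContinuousOn (fun q : I × ↥R.Mpunct => invRadius (diamB 0 face_zero (R.e q.2)))
        {q | q.2 ∈ R.discSet} :=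
      continuousOn_invRadius_diamB.comp R.continuousOn_e_snd fun q hq => R.norm_mem_of_mem_discSet hq
    have hτ : Continuous fun q : I × ↥R.Mpunct => (q.1 : ℝ) := continuous_subtype_val.comp continuous_fst
    exact ((continuous_const.sub hτ).continuousOn.mul h1).add
      (hτ.continuousOn.mul R.continuousOn_e_snd.norm)
  have hsph : ContinuousOn (fun q : I × ↥R.Mpunct => (sphN (R.e q.2) : 𝔼 (m + 1)))
      {q | q.2 ∈ R.discSet} :=
    continuous_subtype_val.comp_continuousOn (continuousOn_sphN.comp R.continuousOn_e_snd hne)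
  have h : ContinuousOn (fun q : I × ↥R.Mpunct =>
      R.i (rsRadius q.1 (R.e q.2) • (sphN (R.e q.2) : 𝔼 (m + 1)))) {q | q.2 ∈ R.discSet} :=
    R.continuous_i.comp_continuousOn (hrad.smul hsph)
  rw [Topology.IsInducing.subtypeVal.continuousOn_iff]
  refine h.congr fun q hq => ?_
  show ((R.homRS q : ↥R.Mpunct) : M) = _
  rw [R.homRS_of_mem_discSet hq]

omit [IsManifold (𝓡 (m + 1)) ∞ M] in
/-- **The radial homotopy is continuous**: it is continuous on the open set `I × discSet`, and the
identity on the open set `I × M'`; these cover. [folklore] -/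
theorem continuous_homRS : Continuous R.homRS := by
  rw [continuous_iff_continuousAt]
  intro q
  by_cases hq : q.2 ∈ R.discSet
  · exact R.continuousOn_homRS_discSet.continuousAt
      ((R.isOpen_discSet.preimage continuous_snd).mem_nhds hq)
  · have hM' : (q.2 : M) ∈ R.M' := R.mem_M'_of_not_mem_discSet hq
    have hopen : IsOpen {q : I × ↥R.Mpunct | (q.2 : M) ∈ R.M'} :=
      R.isOpen_M'Set.preimage continuous_snd
    have heq : EqOn R.homRS (fun q => q.2) {q : I × ↥R.Mpunct | (q.2 : M) ∈ R.M'} :=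
      fun q hq => R.homRS_of_mem_M' hq
    exact (continuous_snd.continuousOn.congr heq).continuousAt (hopen.mem_nhds hM')

/-- At `τ = 0` the radial homotopy is `retr ∘ sect`. [folklore] -/
theorem homRS_zero (y : ↥R.Mpunct) : R.homRS (0, y) = R.retr (R.sect y) := by
  by_cases hy : y ∈ R.discSet
  · rw [R.homRS_of_mem_discSet (q := (0, y)) hy]
    apply Subtype.ext
    rw [R.coe_retr_sect_of_mem_discSet hy]
    simp [rsRadius]
  · rw [R.retr_sect_of_mem_M' (R.mem_M'_of_not_mem_discSet hy)]
    exact dif_neg hy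

omit [IsManifold (𝓡 (m + 1)) ∞ M] in
/-- At `τ = 1` the radial homotopy is the identity. [folklore] -/
theorem homRS_one (y : ↥R.Mpunct) : R.homRS (1, y) = y := by
  by_cases hy : y ∈ R.discSet
  · rw [R.homRS_of_mem_discSet (q := (1, y)) hy]
    have hv0 : R.e y ≠ 0 := norm_pos_iff.1 (R.norm_mem_of_mem_discSet hy).1
    apply Subtype.ext
    simp only [Set.Icc.coe_one, rsRadius, sub_self, zero_mul, one_mul, zero_add]
    rw [norm_smul_coe_sphN hv0, R.i_e hy.1]
  · exact dif_neg hy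

/-- **`retr ∘ sect` is homotopic to the identity of `M ∖ {i 0}`.** [folklore] -/
def homotopyRetrSect : (R.retrCM.comp R.sectCM).Homotopy (ContinuousMap.id ↥R.Mpunct) where
  toFun := R.homRS
  continuous_toFun := R.continuous_homRS
  map_zero_left := R.homRS_zero
  map_one_left := R.homRS_one


/-! ### `sect ∘ retr` -/

omit [IsManifold (𝓡 (m + 1)) ∞ M] in
/-- The point `retrB (w, z)` lies in the punctured unit disc (its coordinate `((1 + ‖z‖)/2) w` has
norm in `[½, 1)`). [folklore] -/
theorem retrB_mem_discSet (b : B m) : R.retrB b ∈ R.discSet :=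
  ⟨R.invPt_mem_source b, by
    show ‖R.e (R.invPt b)‖ < 1
    rw [R.norm_e_invPt]; exact invRadius_lt_one b⟩

omit [T2Space M] [IsManifold (𝓡 (m + 1)) ∞ M] in
/-- The diameter point over `i(((1 + ‖z‖)/2) w)` is `(w, ‖z‖·(0, 1))`: this is `sect (retr (w, z))`.
[folklore] -/
theorem _root_.Literature.Topology.FourManifolds.RotationBody.diamB_invRadius_smul (b : B m) :
    diamB 0 face_zero (invRadius b • (b.1.1 : 𝔼 (m + 1))) =
      mkB b.1.1 (‖(b.1.2 : 𝔼 2)‖ • rot 0) (by rw [norm_smul, norm_rot, mul_one, norm_norm]; exact B_norm_lt b)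
        (by rw [PiLp.smul_apply, smul_eq_mul, rot_zero, E2_apply_zero, mul_zero]) := by
  have hc : 0 < invRadius b ∧ invRadius b < 1 := ⟨invRadius_pos b, invRadius_lt_one b⟩
  have hn : ‖invRadius b • (b.1.1 : 𝔼 (m + 1))‖ = invRadius b := norm_invRadius_smul b
  apply Subtype.ext
  ext : 1
  · show sphN (invRadius b • (b.1.1 : 𝔼 (m + 1))) = b.1.1
    rw [sphN_smul hc.1 (B_fst_ne_zero b), sphN_coe]
  · apply Subtype.ext
    show dV 0 (invRadius b • (b.1.1 : 𝔼 (m + 1))) = ‖(b.1.2 : 𝔼 2)‖ • rot 0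
    rw [dV_of_mem (by rw [hn]; exact hc), hn, invRadius]
    congr 1
    ring

/-- `sect (retr (w, z)) = (w, ‖z‖·(0, 1))` on the half-disc bundle. [folklore] -/
theorem sect_retr_inr (b : B m) :
    R.sect (R.retr (R.glueData.inr b)) = R.glueData.inr
      (mkB b.1.1 (‖(b.1.2 : 𝔼 2)‖ • rot 0)
        (by rw [norm_smul, norm_rot, mul_one, norm_norm]; exact B_norm_lt b)
        (by rw [PiLp.smul_apply, smul_eq_mul, rot_zero, E2_apply_zero, mul_zero])) := by
  rw [retr_inr, R.sect_of_mem_discSet (R.retrB_mem_discSet b)]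
  congr 1
  rw [coe_retrB, R.e_invPt]
  exact diamB_invRadius_smul b

/-- `sect (retr (x, s)) = (x, 0)` on the cylinder. [folklore] -/
theorem sect_retr_inl (a : R.A) :
    R.sect (R.retr (R.glueData.inl a)) = R.glueData.inl (R.mkA a.1.1 0 (mem_Icc_of_face face_zero)) := by
  rw [retr_inl]
  exact R.sect_of_mem_M' (y := R.ptA a) a.1.1.2

/-! ### The homotopy `sect ∘ retr ≃ id` -/

omit [T2Space M] [IsManifold (𝓡 (m + 1)) ∞ M] in
/-- A product of two numbers of `[0, 1]` lies in `[0, 1]`. [folklore] -/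
theorem _root_.Literature.Topology.FourManifolds.RotationBody.mul_mem_Icc {τ s : ℝ} (hτ : τ ∈ Icc (0 : ℝ) 1)
    (hs : s ∈ Icc (0 : ℝ) 1) : τ * s ∈ Icc (0 : ℝ) 1 :=
  ⟨mul_nonneg hτ.1 hs.1, mul_le_one₀ hτ.2 hs.1 hs.2⟩

/-- The homotopy on the cylinder: `(x, s) ↦ (x, τ s)` (at `τ = 0` the face `s = 0`, at `τ = 1` the
identity). [folklore] -/
def homA (τ : I) (a : R.A) : R.W :=
  R.glueData.inl (R.mkA a.1.1 ((τ : ℝ) * a.1.2) (mul_mem_Icc τ.2 (R.A_snd_mem a)))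

/-- The disc coordinate `‖z‖·rot(τ θ(z)/π)` of the homotopy on the half-disc bundle: the point `z` of
the half-disc is moved along the circle of radius `‖z‖` from the diameter point `‖z‖·(0, 1)`
(`τ = 0`) back to `z` (`τ = 1`). [folklore] -/
def _root_.Literature.Topology.FourManifolds.RotationBody.homVec (τ : I) (b : B m) : 𝔼 2 :=
  ‖(b.1.2 : 𝔼 2)‖ • rot ((τ : ℝ) * invAngle b)

omit [T2Space M] [IsManifold (𝓡 (m + 1)) ∞ M] in
/-- `‖‖z‖·rot θ‖ = ‖z‖`. [folklore] -/
@[simp] theorem _root_.Literature.Topology.FourManifolds.RotationBody.norm_homVec (τ : I) (b : B m) :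
    ‖homVec τ b‖ = ‖(b.1.2 : 𝔼 2)‖ := by
  rw [homVec, norm_smul, norm_rot, mul_one, norm_norm]

omit [T2Space M] [IsManifold (𝓡 (m + 1)) ∞ M] in
/-- The disc coordinate of the homotopy stays in the open unit disc. [folklore] -/
theorem _root_.Literature.Topology.FourManifolds.RotationBody.norm_homVec_lt (τ : I) (b : B m) : ‖homVec τ b‖ < 1 := by
  rw [norm_homVec]; exact B_norm_lt b

omit [T2Space M] [IsManifold (𝓡 (m + 1)) ∞ M] in
/-- The disc coordinate of the homotopy stays in the closed right half-plane (the angle `τ θ(z)`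
lies in `[0, π]`). [folklore] -/
theorem _root_.Literature.Topology.FourManifolds.RotationBody.homVec_apply_zero_nonneg (τ : I) (b : B m) :
    0 ≤ homVec τ b 0 := by
  rw [homVec, PiLp.smul_apply, smul_eq_mul]
  exact mul_nonneg (norm_nonneg _) (rot_apply_zero_nonneg (mul_mem_Icc τ.2 (invAngle_mem b)))

/-- The homotopy on the half-disc bundle: `(w, z) ↦ (w, ‖z‖·rot(τ θ(z)/π))`. [folklore] -/
def homB (τ : I) (b : B m) : R.W :=
  R.glueData.inr (mkB b.1.1 (homVec τ b) (norm_homVec_lt τ b) (homVec_apply_zero_nonneg τ b))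

/-- **The two pieces of the homotopy are compatible with the gluing**: for `(w, z) = ψ (x, s)`,
i.e. `w = v/‖v‖`, `z = (2‖v‖ - 1)·rot s`, `v = e x`, one has `θ(z)/π = s`, so
`(w, ‖z‖·rot(τ s)) = ψ (x, τ s)`. [folklore] -/
theorem homA_compat (τ : I) (a : R.A) (ha : a ∈ R.glueData.glue.source) :
    R.homA τ a = R.homB τ (R.glueData.glue a) := by
  have ha0 : a ∈ R.glueSource := ha
  have ha' : R.mkA a.1.1 ((τ : ℝ) * a.1.2) (mul_mem_Icc τ.2 (R.A_snd_mem a)) ∈ R.glueData.glue.source :=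
    ha
  have hr := R.radius_mem_of_mem_glueSource ha0
  have hang : invAngle (R.glueFun a) = a.1.2 := by
    rw [invAngle, glueFun_coe_snd, R.glueVec_of_mem ha0, halfPlaneAngle_smul_rot hr.1 (R.A_snd_mem a),
      mul_div_cancel_left₀ _ Real.pi_ne_zero]
  rw [homA, ← R.glueData.inr_glue ha', homB]
  congr 1
  rw [glueData_glue, glue_apply, glue_apply]
  apply Subtype.ext
  ext : 1
  · rfl
  · apply Subtype.ext
    show R.glueVec (R.mkA a.1.1 ((τ : ℝ) * a.1.2) (mul_mem_Icc τ.2 (R.A_snd_mem a))) =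
      homVec τ (R.glueFun a)
    rw [R.glueVec_of_mem ha', homVec, glueFun_coe_snd, R.norm_glueVec_of_mem ha0, hang]
    rfl

/-- **The homotopy from `sect ∘ retr` to the identity of `W`**, induced on the glued space by
`homA τ` and `homB τ`. [cite: KervaireMilnorAnnals1963, Lemma 2.4, proof (p. 507)] -/
def homSR (q : I × R.W) : R.W :=
  R.glueData.lift (R.homA q.1) (R.homB q.1) (R.homA_compat q.1) q.2

/-- The homotopy on the cylinder (definitional). [folklore] -/
@[simp] theorem homSR_inl (τ : I) (a : R.A) : R.homSR (τ, R.glueData.inl a) = R.homA τ a := rfl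

/-- The homotopy on the half-disc bundle (definitional). [folklore] -/
@[simp] theorem homSR_inr (τ : I) (b : B m) : R.homSR (τ, R.glueData.inr b) = R.homB τ b := rfl

/-- The cylinder piece of the homotopy is jointly continuous in `(τ, (x, s))`. [folklore] -/
theorem continuous_homA : Continuous fun q : I × R.A => R.homA q.1 q.2 := by
  refine R.glueData.continuous_inl.comp ?_
  refine Continuous.subtype_mk ?_ _
  exact (continuous_fst.comp (continuous_subtype_val.comp continuous_snd)).prodMk
    ((continuous_subtype_val.comp continuous_fst).mul
      (continuous_snd.comp (continuous_subtype_val.comp continuous_snd)))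

omit [T2Space M] [IsManifold (𝓡 (m + 1)) ∞ M] in
/-- **The disc coordinate `(τ, (w, z)) ↦ ‖z‖·rot(τ θ(z)/π)` is jointly continuous**, although the
angle `θ(z)` is not continuous at `z = 0`: there the coordinate is squeezed to `0` by the factor
`‖z‖`. [folklore] -/
theorem _root_.Literature.Topology.FourManifolds.RotationBody.continuous_homVec :
    Continuous fun q : I × B m => homVec q.1 q.2 := by
  have hc : Continuous fun q : I × B m => ‖(q.2.1.2 : 𝔼 2)‖ :=
    (continuous_subtype_val.comp (continuous_snd.comp (continuous_subtype_val.comp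
      continuous_snd))).norm
  rw [continuous_iff_continuousAt]
  rintro ⟨τ, b⟩
  by_cases hb : (b.1.2 : 𝔼 2) = 0
  · have h0 : homVec τ b = 0 := by rw [homVec, hb, norm_zero, zero_smul]
    rw [ContinuousAt, h0]
    refine squeeze_zero_norm (fun q => (norm_homVec q.1 q.2).le) ?_
    have h := hc.continuousAt (x := (τ, b))
    rw [ContinuousAt] at h
    simp only [hb, norm_zero] at h
    exact h
  · have hbt : b ∈ (glueTarget : Set (B m)) := hb
    have h1 : ContinuousAt (invAngle ∘ (Prod.snd : I × B m → B m)) (τ, b) :=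
      (continuousOn_invAngle.continuousAt (isOpen_glueTarget.mem_nhds hbt)).comp continuousAt_snd
    have h2 : ContinuousAt (fun q : I × B m => (q.1 : ℝ) * invAngle q.2) (τ, b) :=
      (continuous_subtype_val.comp continuous_fst).continuousAt.mul h1
    exact hc.continuousAt.smul (continuous_rot.continuousAt.comp h2)

/-- The half-disc piece of the homotopy is jointly continuous in `(τ, (w, z))`. [folklore] -/
theorem continuous_homB : Continuous fun q : I × B m => R.homB q.1 q.2 := by
  refine R.glueData.continuous_inr.comp ?_
  refine Continuous.subtype_mk ?_ _
  exact (continuous_fst.comp (continuous_subtype_val.comp continuous_snd)).prodMk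
    (continuous_homVec.subtype_mk _)

/-- **The homotopy `homSR` is continuous** on `I × W`: `I` being locally compact, `I × W` is a
quotient of `I × (A ⊕ B)` (`IsQuotientMap.continuous_lift_prod_right`), on which the homotopy is
`homA` and `homB` on the two open summands. [folklore] -/
theorem continuous_homSR : Continuous R.homSR := by
  refine R.glueData.isQuotientMap_proj.continuous_lift_prod_right ?_
  rw [continuous_iff_continuousAt]
  rintro ⟨τ, x⟩
  rcases x with a | b
  · have he : Topology.IsOpenEmbedding (Prod.map id Sum.inl : I × R.A → I × (R.A ⊕ B m)) :=
      Topology.IsOpenEmbedding.id.prodMap Topology.IsOpenEmbedding.inl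
    have key : (fun p : I × (R.A ⊕ B m) => R.homSR (p.1, R.glueData.proj p.2)) ∘ Prod.map id Sum.inl =
        fun q : I × R.A => R.homA q.1 q.2 := rfl
    have h := he.continuousAt_iff (g := fun p : I × (R.A ⊕ B m) => R.homSR (p.1, R.glueData.proj p.2))
      (x := (τ, a))
    rw [key] at h
    exact h.1 R.continuous_homA.continuousAt
  · have he : Topology.IsOpenEmbedding (Prod.map id Sum.inr : I × B m → I × (R.A ⊕ B m)) :=
      Topology.IsOpenEmbedding.id.prodMap Topology.IsOpenEmbedding.inr
    have key : (fun p : I × (R.A ⊕ B m) => R.homSR (p.1, R.glueData.proj p.2)) ∘ Prod.map id Sum.inr =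
        fun q : I × B m => R.homB q.1 q.2 := rfl
    have h := he.continuousAt_iff (g := fun p : I × (R.A ⊕ B m) => R.homSR (p.1, R.glueData.proj p.2))
      (x := (τ, b))
    rw [key] at h
    exact h.1 R.continuous_homB.continuousAt

/-- At `τ = 0` the homotopy is `sect ∘ retr` on the cylinder. [folklore] -/
theorem homSR_zero_inl (a : R.A) :
    R.homSR (0, R.glueData.inl a) = R.sect (R.retr (R.glueData.inl a)) := by
  rw [sect_retr_inl, homSR_inl, homA]
  congr 1
  apply Subtype.ext
  simp only [mkA_coe, Set.Icc.coe_zero, zero_mul]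

/-- At `τ = 0` the homotopy is `sect ∘ retr` on the half-disc bundle. [folklore] -/
theorem homSR_zero_inr (b : B m) :
    R.homSR (0, R.glueData.inr b) = R.sect (R.retr (R.glueData.inr b)) := by
  rw [sect_retr_inr, homSR_inr, homB]
  congr 1
  apply Subtype.ext
  ext : 1
  · rfl
  · apply Subtype.ext
    show homVec 0 b = ‖(b.1.2 : 𝔼 2)‖ • rot 0
    rw [homVec, Set.Icc.coe_zero, zero_mul]

/-- At `τ = 0` the homotopy is `sect ∘ retr`. [folklore] -/
theorem homSR_zero (p : R.W) : R.homSR (0, p) = R.sect (R.retr p) := by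
  obtain ⟨a, rfl⟩ | ⟨b, rfl⟩ := R.glueData.exists_inl_or_inr p
  · exact R.homSR_zero_inl a
  · exact R.homSR_zero_inr b

omit [T2Space M] [IsManifold (𝓡 (m + 1)) ∞ M] in
/-- At `τ = 1` the disc coordinate of the homotopy is `z` itself (polar decomposition
`z = ‖z‖·rot(θ(z)/π)`). [folklore] -/
theorem _root_.Literature.Topology.FourManifolds.RotationBody.homVec_one (b : B m) : homVec 1 b = (b.1.2 : 𝔼 2) := by
  rw [homVec, Set.Icc.coe_one, one_mul, invAngle]
  by_cases hb : (b.1.2 : 𝔼 2) = 0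
  · rw [hb, norm_zero, zero_smul]
  · exact norm_smul_rot_halfPlaneAngle hb

/-- At `τ = 1` the homotopy is the identity. [folklore] -/
theorem homSR_one (p : R.W) : R.homSR (1, p) = p := by
  obtain ⟨a, rfl⟩ | ⟨b, rfl⟩ := R.glueData.exists_inl_or_inr p
  · rw [homSR_inl, homA]
    congr 1
    apply Subtype.ext
    simp only [mkA_coe, Set.Icc.coe_one, one_mul]
  · rw [homSR_inr, homB]
    congr 1
    apply Subtype.ext
    ext : 1
    · rfl
    · exact Subtype.ext (homVec_one b)

/-- **`sect ∘ retr` is homotopic to the identity of the rotation body.** [cite: KervaireMilnorAnnals1963, Lemma 2.4, proof (p. 507)] -/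
def homotopySectRetr : (R.sectCM.comp R.retrCM).Homotopy (ContinuousMap.id R.W) where
  toFun := R.homSR
  continuous_toFun := R.continuous_homSR
  map_zero_left := R.homSR_zero
  map_one_left := R.homSR_one

/-! ### The homotopy equivalence -/

/-- **The rotation body is homotopy equivalent to the punctured manifold `M ∖ {i 0}`**
(Kervaire–Milnor, *Groups of homotopy spheres I* (1963), proof of Lemma 2.4, p. 507: "`W` contains
`M - Interior i(½Dⁿ)` as deformation retract"; `M - Interior i(½Dⁿ)` is in turn a deformation
retract of `M ∖ {i 0}`). [cite: KervaireMilnorAnnals1963, Lemma 2.4, proof (p. 507)] -/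
def homotopyEquivPunct : R.W ≃ₕ ↥R.Mpunct where
  toFun := R.retrCM
  invFun := R.sectCM
  left_inv := ⟨R.homotopySectRetr⟩
  right_inv := ⟨R.homotopyRetrSect⟩


/-! ### Orientation: `P₀` is the oriented connected sum `(M, o) # (M, -o)` -/

omit [T2Space M] in
/-- Every disc `i = e⁻¹` of rotation data on an oriented manifold preserves orientation for a
suitable constant orientation `o₀` of `ℝᵐ⁺¹` (`exists_isOrientationPreserving_disc`; Kervaire–Milnor
1963, §2: "so that `i₁` preserves orientation"). [folklore] -/
theorem exists_isOrientationPreserving_i (o : SmoothOrientation (𝓡 (m + 1)) M) :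
    ∃ o₀ : Orientation ℝ (𝔼 (m + 1)) (Fin (Module.finrank ℝ (𝔼 (m + 1)))),
      IsOrientationPreserving (SmoothOrientation.modelSpace o₀) o R.i :=
  exists_isOrientationPreserving_disc R.isSmoothEmbedding_i R.isOpenEmbedding_i.isOpen_range o

omit [T2Space M] in
/-- A disc preserving the orientations `(o₀, o)` reverses the orientations `(o₀, -o)` (by
definition of reversing; `-(-o) = o`). This is why the same disc `i` serves on both sides of
Kervaire–Milnor's `M # (-M)` (1963, proof of Lemma 2.4). [folklore] -/
theorem isOrientationReversing_i_neg {o : SmoothOrientation (𝓡 (m + 1)) M}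
    {o₀ : Orientation ℝ (𝔼 (m + 1)) (Fin (Module.finrank ℝ (𝔼 (m + 1))))}
    (h : IsOrientationPreserving (SmoothOrientation.modelSpace o₀) o R.i) :
    IsOrientationReversing (SmoothOrientation.modelSpace o₀) (-o) R.i := by
  rw [isOrientationReversing_iff, neg_neg]
  exact h

/-- **The orientation of the double `P₀ = M # (-M)`** glued from `o` on the first copy and `-o` on
the second (Kervaire–Milnor 1963, §2: "Choose the orientation for `M₁ # M₂` which is compatible
with that of `M₁` and `M₂`"; tree construction `ConnectedSumData.orientation` for the data
`(e, e)`, the disc `i` preserving `(o₀, o)` and reversing `(o₀, -o)`). [cite: KervaireMilnorAnnals1963, §2 p. 505 and Lemma 2.4, proof (p. 507)] -/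
def orientationP₀ (o : SmoothOrientation (𝓡 (m + 1)) M)
    (o₀ : Orientation ℝ (𝔼 (m + 1)) (Fin (Module.finrank ℝ (𝔼 (m + 1)))))
    (h : IsOrientationPreserving (SmoothOrientation.modelSpace o₀) o R.i) :
    SmoothOrientation (𝓡 (m + 1)) R.P₀ :=
  R.csd.orientation hn o (-o) o₀ h (R.isOrientationReversing_i_neg h)

/-- **`P₀ = M # (-M)` is an oriented connected sum of `(M, o)` and `(M, -o)`** in the sense of the
tree's `IsOrientedConnectedSum` (Kervaire–Milnor 1963, proof of Lemma 2.4: "`bW = M # (-M)`", the sum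
formed with the disc `i` on both sides; tree theorem `ConnectedSumData.isOrientedConnectedSum_glued`).
[cite: KervaireMilnorAnnals1963, Lemma 2.4, proof (p. 507)] -/
theorem isOrientedConnectedSum_P₀ (o : SmoothOrientation (𝓡 (m + 1)) M)
    (o₀ : Orientation ℝ (𝔼 (m + 1)) (Fin (Module.finrank ℝ (𝔼 (m + 1)))))
    (h : IsOrientationPreserving (SmoothOrientation.modelSpace o₀) o R.i) :
    IsOrientedConnectedSum o (-o) (R.orientationP₀ o o₀ h) :=
  R.csd.isOrientedConnectedSum_glued hn o (-o) o₀ h (R.isOrientationReversing_i_neg h)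

end RotationData

end Literature.Topology.FourManifolds
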